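import Summits.ResolutionOfSingularities.ResolutionOfSingularities.Theorems.HilbertSamuelEliminationSigmaMaxModificationsCorridor3WLadderStrataScope
import Summits.ResolutionOfSingularities.ResolutionOfSingularities.Theorems.HilbertSamuelEliminationSigmaMaxModificationsCorridor3WLadderStrataCentre
import Literature.AlgebraicGeometry.Resolution.AlterationsNormalFormBlowupParts
import HarnessLib

/-!
# [OURS · L1 W4.2] The STRATA-half of the MOVING W-ladder, third layer: BIRTHS LIE OVER THE CENTRE (proved), and ROW (b)
# `StrataBirthsSettle` REDUCED to the cycle-end kernel (b-end) and the replay row (c-rep) — under `ν ≠ Φ^{(N)}`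

Crux chain w42 (`SigmaMaxModifications`, stmt-ResolutionOfSingularities-18506; skeleton `w_ladder` v5 on
`SigmaMaxModificationsCorridor3`, stmt-ResolutionOfSingularities-19249), row «stub-4 successor → `Moving.Wlow3CharStrataM p`»,
seat res-L1-w42-stub-4 (gen 3); companion of `…Corridor3WLadderStrataLineages` (p500484: strata-half ⟸ (b) ∧ (c)),
`…StrataLabels` (p503069) / `…StrataCentre` (p503885: (c) ⟸ (c-geo) ∧ (c-rep)) and `…StrataScope` (p504439: row (D), `QNe`,
`CycleInv`). OURS (cell res-hironaka, slot W4.2); NOT statements of H. Hironaka's manuscript [Hironaka2017] nor of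
[CossartJannsenSaito2020]; AI-drafted, weaker than expert review. Every `theorem` is PROVED; the open content is the one
`def … : Prop` row (b-end). Helper file `--supports stmt-ResolutionOfSingularities-19249`.

## What is proved

* §1 **BIRTHS LIE OVER THE CENTRE** (`StepProjection.subset_preimage_support_of_not_mem`, under the cycle invariant of
  p504439): along a canonical near step `π : X_{n+1} → X_n`, an irreducible component `Z'` of `X_{n+1}(ν)` which does NOT
  dominate an irreducible component of `X_n(ν)` (`closure π(Z') ∉ componentsIn X_n(ν)`: a NEWBORN component, new label) lies
  inside `π⁻¹(V(C))`. Reason: off `V(C)` the blow-up is an isomorphism and `H^N` is unchanged, so a component with a point off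
  `π⁻¹ V(C)` is the strict transform of the component `closure π(Z')` of `X_n(ν)` (the «⊇» half of the tree's label calculus
  `next_part_eq_strictTransformSet`, re-run for one component). Hence (`isBlownUp_of_birth`) a newborn component THROUGH THE
  CHAIN POINT `x_{n+1}` forces `x_n ∈ V(C_n)`: births through the chain points happen only at BLOWN-UP stages.
* §2 ROW (b-end) `StrataCycleEndBirthsSettle p N Q G` (OPEN, OURS): from some stage on, at a BLOWN-UP CYCLE-END step (the
  centre is the whole treated part `Y_n^{(j)} ∋ x_n`) every component of `X_{n+1}(ν)` through `x_{n+1}` dominates a component of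
  `X_n(ν)`. Intended proof (`G = (ē ≤ 2)`, never isolated): the part of the centre through `x_n` is a regular curve `D` (a
  surface through `x_n` leaves no near point over `x_n`, Thm. 3.14 with `ē ≤ 2`; `x_n` isolated in the centre would make `x_n`
  isolated in `X_n(ν)`), and a newborn component through `x_{n+1}` lies in `π⁻¹(D)` over `x_n`, i.e. in the fibre, whose near
  part is finite (Thm. 3.14: `ℙ(Dir_{x_n}/T_{x_n}D)` is a point) — so it would be `{x_{n+1}}`, not a component at a
  never-isolated point (p504439 `CycleInv.singleton_notMem_componentsIn_of_not_iso`).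
* §2 `strataBirthsSettle_of_replaySettle_of_cycleEnd : (c-rep) → (b-end) → (b)` at `QNe Q` (under `ν ≠ Φ^{(N)}`) — PROVED —
  and THE ASSEMBLY of the whole strata-half: `maxOriginNoMovingNearChainAtQ_notIso_of_kernels :
  (D) → (b-end)@QNe → (c-geo)@QNe → (c-rep)@QNe → MaxOriginNoMovingNearChainAtQ p N Q (G ∧ ¬Iso)`, by name
  `wlow3CharStrataM_of_kernels : … → Wlow3CharStrataM p` and `wlowStrataM_of_kernels`.

So `Wlow3CharStrataM` (G1′) = (D) non-degeneracy ∧ (b-end) ∧ (c-geo) ∧ (c-rep), all four stated under `ν ≠ Φ^{(N)}` where the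
tree's cycle package applies; everything else (Kőnig on lineages, label bookkeeping, cycle ends, births over the centre,
positive-dimensionality of the lineages) is PROVED in this seat's four helper files.

References: CJS LNM 2270 Rem. 6.29 (1) pp. 91–92, p. 105, Thm. 3.14, Prop. 6.31 [CossartJannsenSaito2020]; Görtz–Wedhorn I
(13.19), Prop. 13.91 (3) [GortzWedhorn2020]; tree `…CampaignW42TertiaryStrictTransformParts` (`exists_componentsIn_superset`,
`isIrreducible_strictTransformSet_of_not_subset`, `next_part_eq_strictTransformSet`), `…TertiaryInStratum`
(`strictTransformSet_subset_hsStratum`), `Literature…AlterationsNormalFormBlowupParts` (`strictTransformSet`, `componentsIn`).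
-/

noncomputable section

-- plan-1/idea-2 module setting kept (namespace `…Corridor3.Moving` re-enters `…Corridor3`)
set_option linter.dupNamespace false

open CategoryTheory AlgebraicGeometry TopologicalSpace Topology
open Summit.ResolutionOfSingularities.ResolutionOfSingularities.Theorems.CampaignW42
open Literature.AlgebraicGeometry.Resolution Literature.RingTheory.HilbertSamuel
open Literature.AlgebraicGeometry.CossartJannsenSaito2020
open Summit.ResolutionOfSingularities.ResolutionOfSingularities.Theorems.SigmaMaxModificationsCorridor3

universe u

namespace Summit.ResolutionOfSingularities.ResolutionOfSingularities.Theorems.SigmaMaxModificationsCorridor3.Moving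

variable {R : ∀ S : Scheme.{u}, CentreSeq S → Prop} {N : ℕ} {ν : ℕ → ℕ}

/-! ## §1. Births lie over the centre -/

/-- **BIRTHS LIE OVER THE CENTRE.** Under the cycle invariant (admissible oracle, `ν ≠ Φ^{(N)}`), along a canonical near step
read through its step projection `f : X_{n+1} ⟶ X_n` with canonical centre `C`: an irreducible component `Z'` of `X_{n+1}(ν)`
that does not dominate an irreducible component of `X_n(ν)` lies inside `f⁻¹(V(C))`. [cite: CossartJannsenSaito2020, Rem. 6.29 (1), p. 92]
[cite: GortzWedhorn2020, Prop. 13.91 (3), (13.19) p. 414] -/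
theorem StepProjection.subset_preimage_support_of_not_mem {k : Type u} [Field k] (hRa : OracleAdmissible R)
    (hν : ν ≠ iterPSum N Phi) {s s' : MarkedStage.{u}} (h : CycleInv k R N ν s) {f : s'.W ⟶ s.W}
    (hf : StepProjection R N ν s s' f) {Z' : Set s'.W} (hZ' : Z' ∈ componentsIn (Scheme.hsStratum s'.W N ν))
    (hnot : closure (f.base '' Z') ∉ componentsIn (Scheme.hsStratum s.W N ν)) :
    ∃ (C : s.W.IdealSheafData) (P' : Option (Pending (blowup C))), IsCanonicalStep R N ν s.L s.P C P' ∧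
      Z' ⊆ f.base ⁻¹' (C.support : Set s.W) := by
  have h' : CycleInv k R N ν s' := h.step hRa hν hf.canonicalNearStep
  obtain ⟨C, P', hln, x', hcs, hπ, hcl, hx', e, rfl⟩ := hf
  subst e
  refine ⟨C, P', hcs, ?_⟩
  simp only [eqToHom_refl, Category.id_comp] at hnot ⊢
  haveI := s.ln
  haveI : IsNoetherian s.W := h.isNoetherian
  haveI : IsNoetherian (blowup C) := h'.isNoetherian
  haveI : IsIso (blowup.π C ∣_ ⟨(C.support : Set s.W)ᶜ, C.support.isClosed.isOpen_compl⟩) :=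
    (blowup.isBlowup C).isIso_compl
  -- the strata below and above, closed, with finitely many components; `π` maps the one into the other
  have hY : IsClosed (Scheme.hsStratum s.W N ν) := h.isClosed_hsStratum
  have hY' : IsClosed (Scheme.hsStratum (blowup C) N ν) := h'.isClosed_hsStratum
  have hfin : (componentsIn (Scheme.hsStratum s.W N ν)).Finite := componentsIn.finite _
  have hfin' : (componentsIn (Scheme.hsStratum (blowup C) N ν)).Finite := componentsIn.finite _
  obtain ⟨-, -, -, hmono⟩ := h.centre hRa hν hcs
  have hπY' : (blowup.π C).base '' Scheme.hsStratum (blowup C) N ν ⊆ Scheme.hsStratum s.W N ν := by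
    rintro _ ⟨z, hz, rfl⟩
    exact h.supMax _ ((Scheme.mem_hsStratum_iff.mp hz).symm.le.trans (hmono z))
  have hST : ∀ T, T ⊆ Scheme.hsStratum s.W N ν →
      strictTransformSet (blowup.π C) (C.support : Set s.W) T ⊆ Scheme.hsStratum (blowup C) N ν :=
    fun T hT => strictTransformSet_subset_hsStratum C hT hY'
  -- suppose `Z'` has a point off `π⁻¹ V(C)`; then `closure π(Z')` is a component — contradiction
  rw [← not_not (a := Z' ⊆ _)]
  intro hsub
  apply hnot
  have hne : (Z' ∩ ((blowup.π C).base ⁻¹' (C.support : Set s.W))ᶜ).Nonempty := by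
    rw [← Set.sdiff_eq, Set.nonempty_iff_ne_empty, Ne, Set.sdiff_eq_empty]
    exact hsub
  have hZ'irr : IsIrreducible Z' := componentsIn.isIrreducible hZ'
  have hEπ : IsClosed ((blowup.π C).base ⁻¹' (C.support : Set s.W)) := C.support.isClosed.preimage (blowup.π C).continuous
  -- `D = closure π(Z')` is irreducible, closed, inside `Y`, hence inside a component `Zc` of `Y`
  have hDirr : IsIrreducible (closure (blowup.π C '' Z')) := (hZ'irr.image _ (blowup.π C).continuous.continuousOn).closure
  have hDY : closure (blowup.π C '' Z') ⊆ Scheme.hsStratum s.W N ν :=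
    closure_minimal ((Set.image_mono (componentsIn.subset hZ')).trans hπY') hY
  obtain ⟨Zc, hZc, hDZc⟩ := exists_componentsIn_superset hY hfin hDirr hDY
  -- `Zc ⊄ V(C)`
  obtain ⟨z', hz'Z, hz'E⟩ := hne
  have hZcC : ¬ Zc ⊆ (C.support : Set s.W) := fun hsub' =>
    hz'E (hsub' (hDZc (subset_closure ⟨z', hz'Z, rfl⟩)))
  -- the strict transform of `Zc` is irreducible, inside `Y'`, inside a component `Z₂`
  have hTirr : IsIrreducible (strictTransformSet (blowup.π C) (C.support : Set s.W) Zc) :=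
    isIrreducible_strictTransformSet_of_not_subset C (componentsIn.isIrreducible hZc) hZcC
  have hTY' : strictTransformSet (blowup.π C) (C.support : Set s.W) Zc ⊆ Scheme.hsStratum (blowup C) N ν :=
    hST Zc (componentsIn.subset hZc)
  obtain ⟨Z₂, hZ₂, hTZ₂⟩ := exists_componentsIn_superset hY' hfin' hTirr hTY'
  -- `Z' ⊆ strict transform of `Zc`
  have hZ'T : Z' ⊆ strictTransformSet (blowup.π C) (C.support : Set s.W) Zc := by
    have h1 : Z' ⊆ closure (Z' ∩ ((blowup.π C).base ⁻¹' (C.support : Set s.W))ᶜ) :=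
      subset_closure_inter_of_isPreirreducible_of_isOpen hZ'irr.isPreirreducible hEπ.isOpen_compl ⟨z', hz'Z, hz'E⟩
    refine h1.trans (closure_mono ?_)
    rintro w ⟨hwZ, hwE⟩
    exact ⟨hDZc (subset_closure ⟨w, hwZ, rfl⟩), hwE⟩
  -- `Z' = Z₂` by maximality, so `Z'` IS the strict transform of `Zc`
  have hZ₂Z' : Z₂ ⊆ Z' :=
    (mem_componentsIn_iff.mp hZ').2.2 Z₂ (componentsIn.subset hZ₂) (componentsIn.isIrreducible hZ₂) (hZ'T.trans hTZ₂)
  -- `closure π(Z') = Zc`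
  have hsub2 : Zc ⊆ closure (blowup.π C '' Z') := by
    have hd : Zc ⊆ closure (Zc ∩ (C.support : Set s.W)ᶜ) := by
      refine subset_closure_inter_of_isPreirreducible_of_isOpen (componentsIn.isIrreducible hZc).isPreirreducible
        C.support.isClosed.isOpen_compl ⟨(blowup.π C).base z', hDZc (subset_closure ⟨z', hz'Z, rfl⟩), hz'E⟩
    refine hd.trans (closure_mono ?_)
    rintro w ⟨hwZc, hwE⟩
    obtain ⟨x, hx⟩ := exists_apply_eq_of_isIso_morphismRestrict (blowup.π C) ⟨(C.support : Set s.W)ᶜ, _⟩ hwE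
    refine ⟨x, hZ₂Z' (hTZ₂ (strictTransformSet.preimage_diff_subset (blowup.π C) (C.support : Set s.W) Zc ?_)), hx⟩
    show (blowup.π C).base x ∈ Zc \ (C.support : Set s.W)
    rw [show (blowup.π C).base x = w from hx]
    exact ⟨hwZc, hwE⟩
  have heq : closure (blowup.π C '' Z') = Zc :=
    Set.Subset.antisymm ((mem_componentsIn_iff.mp hZc).2.2 _ hDY hDirr hsub2) hsub2
  rw [heq]
  exact hZc

/-- **A NEWBORN COMPONENT THROUGH THE CHAIN POINT FORCES A BLOWN-UP STAGE**: under the cycle invariant, if some irreducible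
component of `X_{n+1}(ν)` through `x_{n+1}` does not dominate a component of `X_n(ν)`, then `x_n` lies in the canonical centre.
[cite: CossartJannsenSaito2020, Rem. 6.29 (1), p. 92] -/
theorem isBlownUp_of_birth {k : Type u} [Field k] (hRa : OracleAdmissible R) (hν : ν ≠ iterPSum N Phi)
    {s s' : MarkedStage.{u}} (h : CycleInv k R N ν s) {f : s'.W ⟶ s.W} (hf : StepProjection R N ν s s' f)
    {Z' : Set s'.W} (hZ' : Z' ∈ componentsThrough N ν s')
    (hnot : closure (f.base '' Z') ∉ componentsIn (Scheme.hsStratum s.W N ν)) : s.IsBlownUp R N ν := by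
  obtain ⟨C, P', hcs, hsub⟩ := hf.subset_preimage_support_of_not_mem hRa hν h hZ'.1 hnot
  refine ⟨C, P', hcs, ?_⟩
  have := hsub hZ'.2
  rwa [Set.mem_preimage, hf.base_pt] at this

/-! ## §2. Row (b-end) and the reduction of row (b); the assembly of the strata-half -/

/-- [OURS · L1 W4.2] **ROW (b-end) — AT LATE BLOWN-UP CYCLE-END STEPS NO COMPONENT THROUGH THE CHAIN POINT IS NEWBORN.** For every
functional admissible oracle, value `ν`, `Q`-maximal origin of characteristic `p` at level `N` and every MOVING, NEVER-ISOLATED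
`G`-chain from it: from some stage on, whenever `x_n` lies in the canonical centre AND the step is a cycle END (next state between
cycles, `(c (n+1)).P = none`, so the centre is the whole treated part `Y_n^{(j)}`, p503069 `support_eq_part_of_next_none`), every
irreducible component of `X_{n+1}(ν)` through `x_{n+1}` dominates an irreducible component of `X_n(ν)`. Intended proof
(`G = (ē ≤ 2)`): the treated part through `x_n` is a regular curve `D` (not a surface: Thm. 3.14 with `ē ≤ 2` leaves no near point
over `x_n`; not `{x_n}`: the chain is never isolated), a newborn component through `x_{n+1}` lies in `π⁻¹(D)` over `x_n` (births lie
over the centre and off the fibre `π⁻¹(D) ∖ π⁻¹(x_n)` maps onto `D`), hence in the finite near part of the fibre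
`ℙ(Dir_{x_n}/T_{x_n}D)` (Thm. 3.14) — a point, not a component at a never-isolated stage. OURS row, OPEN; NOT a statement of the
manuscript. [cite: CossartJannsenSaito2020, Thm. 3.14, Rem. 6.29 (1)] -/
def StrataCycleEndBirthsSettle (p N : ℕ) (Q : ℕ → (ℕ → ℕ) → ∀ X : Scheme.{u}, X → Prop) (G : MarkedStage.{u} → Prop) : Prop :=
  ∀ (R : ∀ S : Scheme.{u}, CentreSeq S → Prop), OracleFunctional R → OracleAdmissible R →
  ∀ (ν : ℕ → ℕ) (X : Scheme.{u}) [IsLocallyNoetherian X] (x : X), IsMaximalOrigin p N ν X x → Q N ν X x →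
  ∀ c : ℕ → MarkedStage.{u}, Reaches R N ν (MarkedStage.init X x) (c 0) →
    (∀ n, CanonicalNearStep R N ν (c n) (c (n + 1))) → (∀ n, G (c n)) → (∀ n, ¬ Iso N (c n)) →
    (∀ n, ∃ m, n ≤ m ∧ (c m).IsBlownUp R N ν) →
    ∃ n₁, ∀ n, n₁ ≤ n → (c n).IsBlownUp R N ν → (c (n + 1)).P = none →
      ∀ f : (c (n + 1)).W ⟶ (c n).W, StepProjection R N ν (c n) (c (n + 1)) f →
        ∀ Z' ∈ componentsThrough N ν (c (n + 1)), closure (f.base '' Z') ∈ componentsIn (Scheme.hsStratum (c n).W N ν)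

/-- **ROW (b) FROM (c-rep) AND (b-end), under `ν ≠ Φ^{(N)}` — PROVED**: a newborn component through `x_{n+1}` forces a blown-up
stage (`isBlownUp_of_birth`), which (c-rep) makes a cycle end, where (b-end) forbids births.
[cite: CossartJannsenSaito2020, Rem. 6.29 (1), p. 92] -/
theorem strataBirthsSettle_of_replaySettle_of_cycleEnd {p N : ℕ} {Q : ℕ → (ℕ → ℕ) → ∀ X : Scheme.{u}, X → Prop}
    {G : MarkedStage.{u} → Prop} (hrep : StrataReplayBlowupsSettle p N (QNe Q) G)
    (hend : StrataCycleEndBirthsSettle p N (QNe Q) G) : StrataBirthsSettle p N (QNe Q) G := by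
  intro R hRf hRa ν X _ x hX hQ c h0 hstep hG hnI hmov
  have hν : ν ≠ iterPSum N Phi := hQ.2
  obtain ⟨k, _, hinv⟩ := exists_cycleInv_chain hRa hν hX h0 hstep
  obtain ⟨n₁, hn₁⟩ := hrep R hRf hRa ν X x hX hQ c h0 hstep hG hnI hmov
  obtain ⟨n₂, hn₂⟩ := hend R hRf hRa ν X x hX hQ c h0 hstep hG hnI hmov
  refine ⟨max n₁ n₂, fun n hn f hf Z' hZ' => ?_⟩
  by_contra hnot
  have hbu : (c n).IsBlownUp R N ν := isBlownUp_of_birth hRa hν (hinv n) hf hZ' hnot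
  exact hnot (hn₂ n (le_of_max_le_right hn) hbu (hn₁ n (le_of_max_le_left hn) hbu) f hf Z' hZ')

/-- **THE STRATA-HALF ASSEMBLED FROM ITS KERNELS — PROVED**: non-degeneracy (D), the cycle-end births row (b-end), the
dimension-two kernel (c-geo) and the replay row (c-rep), the last three UNDER `ν ≠ Φ^{(N)}` (`QNe Q`), give «no moving,
never-isolated `G`-chain from a `Q`-maximal origin». [cite: CossartJannsenSaito2020, Rem. 6.29 (1), Thm. 6.35, Prop. 6.31] -/
theorem maxOriginNoMovingNearChainAtQ_notIso_of_kernels {p N : ℕ} {Q : ℕ → (ℕ → ℕ) → ∀ X : Scheme.{u}, X → Prop}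
    {G : MarkedStage.{u} → Prop} (hD : MaxOriginMovingNondegenerate.{u} p N)
    (hend : StrataCycleEndBirthsSettle p N (QNe Q) G) (hgeo : StrataLineageInCentreIO p N (QNe Q) G)
    (hrep : StrataReplayBlowupsSettle p N (QNe Q) G) :
    MaxOriginNoMovingNearChainAtQ p N Q fun s => G s ∧ ¬ Iso N s :=
  maxOriginNoMovingNearChainAtQ_of_qNe hD
    (maxOriginNoMovingNearChainAtQ_notIso_of_lineages (strataBirthsSettle_of_replaySettle_of_cycleEnd hrep hend)
      (strataLineagesFinite_of_centreIO_of_replaySettle hgeo hrep))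

/-- **`Wlow3CharStrataM p` (G1′ in the (F1) regime) FROM THE FOUR KERNELS** (by name; `N = 3`, `Q = QCharRegime p`, `G = (ē ≤ 2)`).
[cite: CossartJannsenSaito2020, Thm. 6.35, Prop. 6.31, Rem. 6.29 (1)] -/
theorem wlow3CharStrataM_of_kernels {p : ℕ} (hD : MaxOriginMovingNondegenerate.{0} p 3)
    (hend : StrataCycleEndBirthsSettle.{0} p 3 (QNe (Helpers.QCharRegime p)) fun s => s.geomDirDim ≤ 2)
    (hgeo : StrataLineageInCentreIO.{0} p 3 (QNe (Helpers.QCharRegime p)) fun s => s.geomDirDim ≤ 2)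
    (hrep : StrataReplayBlowupsSettle.{0} p 3 (QNe (Helpers.QCharRegime p)) fun s => s.geomDirDim ≤ 2) :
    Wlow3CharStrataM p :=
  maxOriginNoMovingNearChainAtQ_notIso_of_kernels hD hend hgeo hrep

/-- **`WlowStrataM p` (G1′, regime-free) FROM THE FOUR KERNELS** (`Q = ⊤`). [cite: CossartJannsenSaito2020, Thm. 6.35, Prop. 6.31] -/
theorem wlowStrataM_of_kernels {p : ℕ} (hD : MaxOriginMovingNondegenerate.{0} p 3)
    (hend : StrataCycleEndBirthsSettle.{0} p 3 (QNe fun _ _ _ _ => True) fun s => s.geomDirDim ≤ 2)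
    (hgeo : StrataLineageInCentreIO.{0} p 3 (QNe fun _ _ _ _ => True) fun s => s.geomDirDim ≤ 2)
    (hrep : StrataReplayBlowupsSettle.{0} p 3 (QNe fun _ _ _ _ => True) fun s => s.geomDirDim ≤ 2) :
    WlowStrataM p :=
  maxOriginNoMovingNearChainAt_of_atQ_true (maxOriginNoMovingNearChainAtQ_notIso_of_kernels hD hend hgeo hrep)

/-- **The registered row `stub_Wlow3M_char`'s content, ASSEMBLED**: F-key (`KeyTheorem640_char_isolated`), the units-half pieces of
the module (`IsoLowDirDimTerminatesM`, `UnitTowerExtractionQM`) and the four strata kernels give `Wlow3CharM p`.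
[cite: CossartJannsenSaito2020, Thm. 6.40, Cor. 6.37, Thm. 6.35] -/
theorem wlow3CharM_of_extraction_of_kernels {p : ℕ} (hK : KeyTheorem640_char_isolated.{0})
    (hlow : IsoLowDirDimTerminatesM p) (hext : UnitTowerExtractionQM p) (hD : MaxOriginMovingNondegenerate.{0} p 3)
    (hend : StrataCycleEndBirthsSettle.{0} p 3 (QNe (Helpers.QCharRegime p)) fun s => s.geomDirDim ≤ 2)
    (hgeo : StrataLineageInCentreIO.{0} p 3 (QNe (Helpers.QCharRegime p)) fun s => s.geomDirDim ≤ 2)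
    (hrep : StrataReplayBlowupsSettle.{0} p 3 (QNe (Helpers.QCharRegime p)) fun s => s.geomDirDim ≤ 2) : Wlow3CharM.{0} p :=
  wlow3CharM_assembled hK hlow hext (wlow3CharStrataM_of_kernels hD hend hgeo hrep)

end Summit.ResolutionOfSingularities.ResolutionOfSingularities.Theorems.SigmaMaxModificationsCorridor3.Moving

end
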